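import Summits.BirchSwinnertonDyer.Rank1Residual.F1Sign2.KummerDeformationAtTwo
import Literature.NumberTheory.EllipticCurves.CuspFormTwist
import Literature.NumberTheory.EllipticCurves.TwistedLValueSeries
import HarnessLib

/-!
# AN-41 kernel — -an g24's kernel lemmas K41.1–3 (`sl₂(𝔽₂) = 𝔽₂ ⊕ E[2]` as `GL₂(𝔽₂)`-modules and the digit trace formula; all `decide` on
# `Matrix (Fin 2) (Fin 2) (ZMod 2)`) and REF1 §207's BC7 kernel certificates K207.1–9 for `KummerDeformationAtTwo.lean` (typer -ty g19; proofs only, no new `def`)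

Sources: `HOME/MEMO-an-data/g24/lean/Sketch_g24.lean` (AN-41 part; the statement file was ported from revision 4fee0acee7fec01d, -an g24 keeps extending only the AN-42 tail) §41.0 (theorems `iota_add`, `iota_conj`, `sl2_decomp`, `sl2_direct`, `trace_iota_mul`, `bit_coboundary`,
l.55–86, VERBATIM — byte-identical in REF1's audited copy **050683ca6b10fc87** and in `Probe207.lean`) and `HOME/REF1-data/b207/Probe207.lean` **3a23417ad62b71fa** (K207.1 `K207_1`, K207.1′
`K207_1'`, K207.2 `K207_2`, K207.2′ `K207_2'`, K207.3 `K207_3`, K207.3′ `K207_3'`, K207.4 `K207_4`, K207.5 `K207_5` / `K207_5'`, K207.6 `K207_6`, K207.7 `K207_7`, K207.8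
`K207_8`, K207.9 `K207_9` — statements and proofs VERBATIM; the probe's `#print axioms` lines dropped, a docstring added to `K207_5'` which had none; REF1 §207 (A1): farm
rc 0, `#print axioms` of all = [propext, Classical.choice, Quot.sound]).  What they certify (REF1 §207 BC7 table): K207.1/1′ the digit bit `[g involution ∧ g v ≠ v]` is the
Weil pairing `⟪w, v⟫` with the fixed vector `w` of the involution `g = ι w`; K207.2/2′ the bit vanishes at elements of order 3 = exactly the trace-`1` elements (`a_ℓ` odd ⟺
`Frob_ℓ` a 3-cycle); K207.3/3′ identity and involutions have trace `0` (scalar part invisible off 3-cycles; AN-41b predicts `a′ ≡ a (mod 4)` at split primes — 1 262/1 262);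
K207.4 additivity of the bit (`t_{P+Q} = t_P + t_Q` with K41.3); K207.5/5′ the point Kummer bit of `O` is `0`; K207.6 AN-41a's conclusion at `P = O` is witnessed by `G = 0`,
`(e₁,e₂,e₄) = (1,0,0)` (not vacuous, degenerate instance TRUE); K207.7 `¬(all eᵢ even) ⟺ v̄ ≠ 0` (`a₁ = 1`, read `n = 1, 2, 4`); K207.8 AN-41b's degenerate instance `W′ = W`
is TRUE (`D = 1`, `g = X⁴`, `S = ∅`); K207.9 the scalar part `h` of `M = h·1 + ι∘c` is defined only modulo `sgn∘ρ̄` (basis change `u = 1 + 2X` adds `tr(X)·[g involution]·1 + ι v`).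
`heckeDefect` in K207.6 is AN-40's `…ANg23.heckeDefect` (opened by name in the statement file and here).  Nothing here bears on BSD; 23715 not closed.
-/

namespace Summit.BirchSwinnertonDyer.Rank1Residual.F1Sign2.ANg24

open Literature.NumberTheory.EllipticCurves Literature.NumberTheory.EllipticCurves.ModularForms UpperHalfPlane
open Summit.BirchSwinnertonDyer.Rank1Residual.F1Sign2
open Summit.BirchSwinnertonDyer.Rank1Residual.F1Sign2.TranspositionDoor
open scoped ModularForm
open CongruenceSubgroup
open Summit.BirchSwinnertonDyer.Rank1Residual.F1Sign2.ANg23 (heckeDefect)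
open scoped Classical

/-! ## -an g24's kernel lemmas K41.1–3 (Sketch_g24 §41.0, l.54–86; VERBATIM; all `decide`) -/

/-- K41.1 (additivity): `ι (v + w) = ι v + ι w` — `{0, τ₁, τ₂, τ₃}` is a subspace and `v ↦ τ_v` is linear. -/
theorem iota_add : ∀ v w : Fin 2 → ZMod 2, iota (v + w) = iota v + iota w := by decide

/-- K41.1' (equivariance): `g (ι v) g⁻¹ = ι (g v)` for every `g ∈ GL₂(𝔽₂)` (stated as `g ι(v) = ι(g v) g` over all invertible `g`). -/
theorem iota_conj : ∀ (g : Matrix (Fin 2) (Fin 2) (ZMod 2)) (v : Fin 2 → ZMod 2), g.det ≠ 0 →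
    g * iota v = iota (g.mulVec v) * g := by decide

/-- K41.1'' (complement): every trace-zero matrix is uniquely `h•1 + ι v`; with K41.1/1' this is `sl₂(𝔽₂) ≅ 𝔽₂ ⊕ E[2]` as
`GL₂(𝔽₂)`-modules. -/
theorem sl2_decomp : ∀ M : Matrix (Fin 2) (Fin 2) (ZMod 2), M.trace = 0 →
    ∃ h : ZMod 2, ∃ v : Fin 2 → ZMod 2, M = h • (1 : Matrix (Fin 2) (Fin 2) (ZMod 2)) + iota v := by decide

/-- K41.1''' (directness): `h•1 + ι v = 0` only for `h = 0, v = 0`. -/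
theorem sl2_direct : ∀ (h : ZMod 2) (v : Fin 2 → ZMod 2),
    h • (1 : Matrix (Fin 2) (Fin 2) (ZMod 2)) + iota v = 0 → h = 0 ∧ v = 0 := by decide

/-- K41.2 (the digit trace formula): for `g ∈ GL₂(𝔽₂)` and `v`, `tr(ι(v)·g) = [g is an involution and g v ≠ v]`
(`= 0` when `g = 1`, when `g` has order `3`, and when `g` is the involution fixing `v`).  With `ρ' = (1 + 2(hI + ι∘c))ρ`:
`tr ρ'(F) − tr ρ(F) ≡ 2(h(F)·tr ρ̄(F) + tr(ι(c F) ρ̄(F))) (mod 4)`. -/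
theorem trace_iota_mul : ∀ (g : Matrix (Fin 2) (Fin 2) (ZMod 2)) (v : Fin 2 → ZMod 2), g.det ≠ 0 →
    (iota v * g).trace = (if g * g = 1 ∧ g ≠ 1 ∧ g.mulVec v ≠ v then 1 else 0) := by decide

/-- K41.3 (class function): the bit `[g involution ∧ g v ≠ v]` only depends on `v` modulo `(g − 1)𝔽₂²` — so `t_c(Frob)` is
well defined on the cohomology class of `c`. -/
theorem bit_coboundary : ∀ (g : Matrix (Fin 2) (Fin 2) (ZMod 2)) (v u : Fin 2 → ZMod 2), g.det ≠ 0 → g * g = 1 →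
    (g.mulVec (v + (g.mulVec u - u)) ≠ v + (g.mulVec u - u) ↔ g.mulVec v ≠ v) := by decide

/-! ## REF1 §207 kernel certificates K207.1–9 (Probe207.lean l.179–282; statements and proofs VERBATIM; sorry-free; std axioms) -/

/-- K207.1 (the digit bit is the Weil pairing with the fixed vector): for `w ≠ 0`, `τ_w v ≠ v ↔ ⟪w,v⟫ = 1`;
so `t_c(ℓ) = ⟪w_ℓ, c(Frob_ℓ)⟫` at a transposition prime with fixed vector `w_ℓ`. -/
theorem K207_1 : ∀ w v : Fin 2 → ZMod 2, w ≠ 0 → ((iota w).mulVec v ≠ v ↔ weil w v = 1) := by decide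

/-- K207.1′: the involutions of `GL₂(𝔽₂)` are exactly the `ι w`, `w ≠ 0` (so K41.2's bit is K207.1's pairing). -/
theorem K207_1' : ∀ g : Matrix (Fin 2) (Fin 2) (ZMod 2), g.det ≠ 0 → g * g = 1 → g ≠ 1 →
    ∃ w : Fin 2 → ZMod 2, w ≠ 0 ∧ g = iota w := by decide

/-- K207.2 (invisibility at `a_ℓ`-odd primes): at an element of order `3` the digit bit vanishes for every `v`. -/
theorem K207_2 : ∀ (g : Matrix (Fin 2) (Fin 2) (ZMod 2)) (v : Fin 2 → ZMod 2), g.det ≠ 0 →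
    g * g * g = 1 → g ≠ 1 → (iota v * g).trace = 0 := by decide

/-- K207.2′ (`a_ℓ` odd ⟺ `Frob_ℓ` a `3`-cycle): in `GL₂(𝔽₂)` the trace is `1` exactly on the elements of order `3`. -/
theorem K207_2' : ∀ g : Matrix (Fin 2) (Fin 2) (ZMod 2), g.det ≠ 0 →
    (g.trace = 1 ↔ (g * g * g = 1 ∧ g ≠ 1)) := by decide

/-- K207.3 (scalar part invisible off the `3`-cycles): identity and involutions have trace `0`, so `h(ℓ)·a_ℓ ≡ 0 (mod 2)`
at split and transposition primes — AN-41b predicts `a_ℓ(E') ≡ a_ℓ(E) (mod 4)` at every SPLIT prime (bit and scalar both `0`). -/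
theorem K207_3 : ∀ g : Matrix (Fin 2) (Fin 2) (ZMod 2), g.det ≠ 0 → g * g = 1 → g.trace = 0 := by decide

/-- K207.3′: at the identity the digit bit is `0` for every `v`. -/
theorem K207_3' : ∀ v : Fin 2 → ZMod 2, (iota v * 1).trace = 0 := by decide

/-- K207.4 (additivity of the bit in the class): `tr(ι(v+w) g) = tr(ι v g) + tr(ι w g)` — with K41.3, `t` is a homomorphism
`H¹(G, E[2]) → Maps(transposition primes, 𝔽₂)`; in particular `t_{P+Q} = t_P + t_Q`. -/
theorem K207_4 : ∀ (g : Matrix (Fin 2) (Fin 2) (ZMod 2)) (v w : Fin 2 → ZMod 2),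
    (iota (v + w) * g).trace = (iota v * g).trace + (iota w * g).trace := by decide

/-- K207.5 (degenerate point): the point Kummer bit of `O` is `0` at every `p` (`Õ = 2·Õ`). -/
theorem K207_5 (W : WeierstrassCurve ℚ) [W.IsIntegral ℤ] (p : ℕ) : ¬ PointKummerBitAt W 0 p := by
  rintro ⟨hp, -, h⟩
  haveI : Fact p.Prime := ⟨hp⟩
  exact h 0 (by rw [nsmul_zero]; exact reducePointAt_zero W p)

/-- K207.5′ (REF1 §207; the probe's undocumented companion of K207.5): the integer point Kummer bit of `O` is `0`. -/
theorem K207_5' (W : WeierstrassCurve ℚ) [W.IsIntegral ℤ] (p : ℕ) : pointKummerBit W 0 p = 0 := by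
  simp [pointKummerBit, K207_5]

/-- K207.6 (AN-41a's conclusion at `P = O` is witnessed by `G = 0`, `v = f̄`): the `∃` is not vacuous and the degenerate
instance is TRUE (not junk-false). -/
theorem K207_6 (W : WeierstrassCurve ℚ) [W.IsIntegral ℤ] :
    ∃ (G : CuspForm (Gamma0 (4 * W.conductorNorm ℤ)) 2) (z : ℕ → ℤ) (e₁ e₂ e₄ : ℤ),
        ¬ (Even e₁ ∧ Even e₂ ∧ Even e₄) ∧
        (∀ n : ℕ, cuspCoeff G n = (z n : ℂ)) ∧
        ∀ ℓ : ℕ, ℓ.Prime → ℓ ≠ 2 → ℓ ≠ W.conductorNorm ℤ →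
          ∀ n : ℕ, 0 < n →
            Even (heckeDefect (fun m => W.LFunction m) ℓ z n - pointKummerBit W (0 : W.toAffine.Point) ℓ *
              (e₁ * W.LFunction n + e₂ * (if 2 ∣ n then W.LFunction (n / 2) else 0) +
                e₄ * (if 4 ∣ n then W.LFunction (n / 4) else 0))) := by
  refine ⟨0, fun _ => 0, 1, 0, 0, by norm_num, fun n => ?_, fun ℓ _ _ _ n _ => ?_⟩
  · rw [cuspCoeff_zero_form one_mem_strictPeriods_Gamma0 n]; simp
  · simp [heckeDefect, K207_5']

/-- K207.7 (the old vector is nonzero mod 2): `f̄, f̄|V₂, f̄|V₄` are independent over `𝔽₂` — if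
`e₁ a_n + e₂ a_{n/2} + e₄ a_{n/4}` is even for all `n ≥ 1` and `a₁ = 1` then all `eᵢ` are even (read at `n = 1, 2, 4`). -/
theorem K207_7 (a : ℕ → ℤ) (h1 : a 1 = 1) (e₁ e₂ e₄ : ℤ)
    (h : ∀ n : ℕ, 0 < n → Even (e₁ * a n + e₂ * (if 2 ∣ n then a (n / 2) else 0) +
      e₄ * (if 4 ∣ n then a (n / 4) else 0))) : Even e₁ ∧ Even e₂ ∧ Even e₄ := by
  have H1 := h 1 (by norm_num)
  have H2 := h 2 (by norm_num)
  have H4 := h 4 (by norm_num)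
  norm_num [h1] at H1 H2 H4
  have he₂ : Even e₂ := (Int.even_add.mp H2).mp (H1.mul_right _)
  refine ⟨H1, he₂, ?_⟩
  have : Even (e₁ * a 4 + e₂ * a 2) := (H1.mul_right _).add (he₂.mul_right _)
  exact (Int.even_add.mp H4).mp this

/-- K207.8 (AN-41b's degenerate instance `W' = W` is TRUE: `D = 1`, `g = X⁴`, `S = ∅`). -/
theorem K207_8 (W : WeierstrassCurve ℚ) [W.IsGloballyMinimal] :
    ∃ (D : ℤ) (g : Polynomial ℤ) (S : Finset ℕ), D ≠ 0 ∧ g.Monic ∧ g.natDegree = 4 ∧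
      ∀ ℓ : ℕ, ℓ.Prime → ℓ ∉ S →
        (4 : ℤ) ∣ W.frobeniusTrace ℓ - W.frobeniusTrace ℓ -
          2 * ((if Odd (W.frobeniusTrace ℓ) ∧ jacobiSym D ℓ = -1 then 1 else 0) +
               (if Irreducible (g.map (Int.castRingHom (ZMod ℓ))) then 1 else 0)) := by
  refine ⟨1, Polynomial.X ^ 4, ∅, one_ne_zero, Polynomial.monic_X_pow 4, by simp, fun ℓ hℓ _ => ?_⟩
  have h2 : ¬ Irreducible ((Polynomial.X : Polynomial (ZMod ℓ)) ^ 4) := not_irreducible_pow (by decide)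
  simp [jacobiSym.one_left, h2]

/-- K207.9 (WHY `χ_{N*}` IS INVISIBLE — the scalar part `h` of the difference cocycle `M = h·1 + ι∘c` is defined only
modulo `sgn ∘ ρ̄ = χ_{Δ} = χ_{N*}`): changing the basis of `E'[4]` by `u = 1 + 2X` replaces `M` by `M + (X + gXg⁻¹)`, and the
scalar part of the coboundary `X + gXg⁻¹` is `tr(X)·[g odd]` (`[g odd]` = `g` an involution = the sign character of
`GL₂(𝔽₂) ≅ S₃`).  Stated over pairs `g g' = 1`. -/
theorem K207_9 : ∀ (g g' X : Matrix (Fin 2) (Fin 2) (ZMod 2)), g * g' = 1 →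
    ∃ v : Fin 2 → ZMod 2, X + g * X * g' =
      (if g * g = 1 ∧ g ≠ 1 then X.trace else 0) • (1 : Matrix (Fin 2) (Fin 2) (ZMod 2)) + iota v := by decide

end Summit.BirchSwinnertonDyer.Rank1Residual.F1Sign2.ANg24
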